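import Summits.AtomisticToContinuum.Crystallization.Theorems.FrustratedLawDichotomyAtlasReachTexturedNearFar
import Summits.AtomisticToContinuum.Crystallization.Theorems.FrustratedLawDichotomyAtlasReachErgodicRegimes
import Summits.AtomisticToContinuum.Crystallization.Theorems.GrainCoreNetworkSplitMuEquilibriumDoor
import Summits.AtomisticToContinuum.Crystallization.Theorems.FrustratedLawDichotomyLFIRangeCut

/-!
# FrustratedLawDichotomy · crux `AperiodicFrustratedLawGap` (stmt-AtomisticToContinuum-27623) — GSC-TYPED SYMMETRIC-AVERAGE DOORS
# (decomp-a2c hand-2 g51; ORDER (482), crit-1 g44 r1959 (D): the pointwise K2″ currency re-typed over {7/10-hard-core, e⋆-μGSC, ApprM})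

r1959 (C) found a loophole in every pointwise symmetric-average currency typed over the NashM class ((473) off-row strict gap, (478) (LFI),
(480) NEAR/FAR): «pressurised cost export» — single-site Nash is compatible with an over-coordinated, externally compressed halo whose cost is booked
OUTSIDE the averaging ball.  The repair is free: an admissible MINIMISING law is almost surely carried by e⋆-μGSC configurations (item 27073
`…GrainCoreNetworkSplit.MuEquilibriumDoor`, PROVED on the tree as `…GrainCoreNetworkSplitMuEquilibriumDoor.muEquilibriumDoor_holds` = `…EquilibriumInLaw.stub_equilibriumInLaw` ∘
`unimodularEnergyLowerBound_proof`: no finite modification `xf ↦ R` lowers `U + I − e⋆·#`), and the μGSC clause forbids positive fields / pressurised halos (`binding ≤ e⋆ < 0` at every atom).  So every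
pointwise slot may carry the μGSC clause as an extra antecedent, at no cost to the door.  «Most general lemma first»:

* §1 **slots typed over ANY almost-sure consequence `G` of admissibility-and-minimality** (hypothesis `hG`: every probability law that is a.s. rooted
  `7/10`-hard-core, point-stationary and has `E[rootEnergy] ≤ e⋆` satisfies `G` almost surely): the reach theorem with a null ledger
  (`coherentMassExclusion_of_floorsL_typed`, #132/(478) proof), its symmetric-currency form (`…_of_symAvg_typed`, (473) transport identity), the strict door
  with rows (`aperiodicFrustratedLawGap_of_typedSymGap`, (473) §6 / (478) §4 proof verbatim), the row-free local gap (`…_of_typedLocalGap`), the NEAR/FAR split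
  of (480) (`…_of_typedLocalGap_nearFar`), and the LAW-LEVEL form `noAdmissibleMinimiserWith_of_aeTyped` (every regime of (404) may assume «a.s. `G`»).
  Antecedents of every pointwise slot: `IsRootedHardCore (7/10) μ → NashM μ → G μ → (∃ R₇ R₈ R₉, ApprM μ R₇ R₈ R₉) → …` (Nash kept for the certifier's
  convenience; clause (e) supplies it).
* §2 ★★ **THE INSTANCE OF RECORD `G := e⋆-μGSC`** (27073's NAME-FREE clause VERBATIM; `hG` = `ae_muGSC_of_minimising` = the door
  `muEquilibriumDoor_holds (7/10)` BY NAME): ★ `aperiodicFrustratedLawGap_of_gscLocalGap`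
  — r1959's signature exactly: `(hgap : ∀ μ, IsRootedHardCore (7/10) μ → «μGSC» → (∃ R₇ R₈ R₉, ApprM μ R₇ R₈ R₉) → eStar + g ≤ symAvgEnergy r μ)` ⟹ crux (NO Nash
  antecedent: single-site Nash is the `n = k = 1` instance of the clause); `…_of_gscSymGap` (K rows), `…_of_gscLocalGap_nearFar` ((480) geography),
  `noAdmissibleMinimiserWith_of_aeGSC` and the #137 composition `aperiodicFrustratedLawGap_of_invariantSplit_gsc`.

* §3 the same doors in the route's NAMED vocabulary: the clause IS `MuGM μ` of (16) `…RecurrentMemberDefs` (`= IsMuGSC lennardJones eStar {atoms}`) by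
  `Iff.rfl` (`muGM_iff_clause`; the Literature `MuGSC`/`MuGroundStateConfiguration` duplication is resolved on the tree, co-import checked on the farm), so
  `aperiodicFrustratedLawGap_of_muGMLocalGap`, `…_of_muGMSymGap`, `…_of_muGMLocalGap_nearFar` read `IsRootedHardCore (7/10) μ → MuGM μ → (∃ R₇ R₈ R₉, ApprM …) → …`.

* §4 (ED1, r1960/r1962 amendment) the [FIN] currency of record: (481)'s finite windows `TexturedWindowGapOn` at `K := MuGM` (∧ `NearAffine` / ∧ `¬NearAffine`),
  `aperiodicFrustratedLawGap_of_gscWindowGap` / `…_nearFar` / `…_nearFar_sharp` (R_N = 13, R_F = 7, tails discharged by (481) `siteTailFloorSharp`).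

BOOK (r1959): from (482) on, every pointwise K2″ leaf is typed over {7/10-hard-core, e⋆-μGSC, ApprM}; the NashM-class doors (478)/(480) stay as instruments.
HONEST LABELS: junction / re-typing only; nothing priced; the doors are WEAKER-by-design than the crux exactly as their NashM parents.  DEF-FREE (theorems
only); imports TREE (480) `…NearFar` (hence (478), (473), #135), #137 `…ErgodicRegimes`, `…GrainCoreNetworkSplitMuEquilibriumDoor` (27073) and (481) `…LFIRangeCut`;
no instance / notation / option; 0 sorry.  Tags: [new: junction].
-/

noncomputable section

namespace Summit.AtomisticToContinuum.Crystallization.Theorems.FrustratedLawDichotomyAtlasReachGSC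

open MeasureTheory Metric Set Filter
open scoped ENNReal BigOperators
open Literature.MathematicalPhysics.StatisticalMechanics Literature.Probability.Process
open Summit.AtomisticToContinuum.Crystallization.Theorems.ChargedEnergyGapNegative (E3 eStar)
open Summit.AtomisticToContinuum.Crystallization.Theorems.RepetitiveNetworkReductionRecurrentMember (ApprM NashM MuGM)
open Summit.AtomisticToContinuum.Crystallization.Theorems.FrustratedLawDichotomySignedLedger (net)
open Summit.AtomisticToContinuum.Crystallization.Theorems.FrustratedLawDichotomyTransportPriceSurplus (exists_measurable_rootEnergy_surrogate)
open Summit.AtomisticToContinuum.Crystallization.Theorems.FrustratedLawDichotomyAtlasReach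
  (reach NoAdmissibleMinimiserWith CoherentMassExclusion OffAtlasMassGap noAdmissibleMinimiserWith_mono aperiodicFrustratedLawGap_of_massSplit
    aperiodicFrustratedLawGap_of_noAdmissibleMinimiser)
open Summit.AtomisticToContinuum.Crystallization.Theorems.FrustratedLawDichotomyAtlasReachLedger (lt_integral_rootEnergy_of_massLedger)
open Summit.AtomisticToContinuum.Crystallization.Theorems.FrustratedLawDichotomySymSharing
  (symShare symAvgEnergy transported_eq_symAvgEnergy symShare_nullLedger extendRow extendMargin measurableSet_extendRow iUnion_extendRow_eq_univ
    noAdmissibleMinimiserWith_of_forall_not)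
open Summit.AtomisticToContinuum.Crystallization.Theorems.FrustratedLawDichotomyAtlasReachTexturedNearFar (NearAffine)
open Summit.AtomisticToContinuum.Crystallization.Theorems.FrustratedLawDichotomyAtlasReachErgodicRegimes (aperiodicFrustratedLawGap_of_invariantSplit)
open Summit.AtomisticToContinuum.Crystallization.Theorems.GrainCoreNetworkSplitMuEquilibriumDoor (muEquilibriumDoor_holds)
open Summit.AtomisticToContinuum.Crystallization.Theorems.FrustratedLawDichotomyLFIRangeCut
  (TexturedWindowGapOn SiteTailFloor tauSharp texturedLocalGapOn_of_rangeCut siteTailFloorSharp siteTailFloor_seven_thirteen)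

/-! ## §1. Slots typed over an arbitrary almost-sure consequence `G` of admissibility and minimality -/

section Typed

variable (G : Measure E3 → Prop)

/-- ★★ **THE REACH THEOREM WITH `G`-TYPED SLOTS** ((478) `coherentMassExclusion_of_floorsL_textured` with one more antecedent).  `G` is any property
that every probability law a.s. carried by rooted `7/10`-hard-core configurations, point-stationary, with `E[rootEnergy] ≤ e⋆` has ALMOST SURELY (`hG`).
A null ledger `Φ`; floors `e⋆ + m_i ≤ rootEnergy μ + Φ μ` at the rooted hard-core, Nash, `G`, textured configurations of row `i < n` (margins `≥ m > 0`);
a cap `e⋆ − rootEnergy μ − Φ μ ≤ D` at the rooted hard-core, Nash, `G`, textured configurations outside every row ⟹ F(η) for every `η ≤ reach m D`.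
[new: junction] -/
theorem coherentMassExclusion_of_floorsL_typed
    (hG : ∀ P : Measure (Measure E3), IsProbabilityMeasure P → (∀ᵐ μ ∂P, IsRootedHardCore (7 / 10) μ) → IsPointStationaryLaw P →
      (∫ μ, rootEnergy lennardJones μ ∂P) ≤ (⨅ Q : PeriodicConfiguration 3, Q.energyPerParticle lennardJones) → ∀ᵐ μ ∂P, G μ)
    (n : ℕ) (K : ℕ → Set (MeasureTheory.Measure (EuclideanSpace ℝ (Fin 3))))
    (hK : ∀ i, MeasurableSet (K i)) (mK : ℕ → ℝ) (Φ : Measure E3 → ℝ)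
    (hΦ : ∀ P : Measure (Measure E3), IsProbabilityMeasure P → (∀ᵐ μ ∂P, IsRootedHardCore (7 / 10) μ) → IsPointStationaryLaw P →
      Integrable Φ P ∧ ∫ μ, Φ μ ∂P ≤ 0)
    (hfloorG : ∀ i < n, ∀ μ : Measure E3, IsRootedHardCore (7 / 10) μ → NashM μ → G μ → (∃ R₇ R₈ R₉ : ℝ, ApprM μ R₇ R₈ R₉) →
      μ ∈ K i → eStar + mK i ≤ rootEnergy lennardJones μ + Φ μ)
    {m D : ℝ} (hm0 : 0 < m) (hD : 0 ≤ D) (hm : ∀ i < n, m ≤ mK i)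
    (hcapG : ∀ μ : Measure E3, IsRootedHardCore (7 / 10) μ → NashM μ → G μ → (∃ R₇ R₈ R₉ : ℝ, ApprM μ R₇ R₈ R₉) →
      μ ∉ (⋃ i ∈ Finset.range n, K i) → eStar - rootEnergy lennardJones μ - Φ μ ≤ D)
    {η : ℝ} (hη : η ≤ reach m D) : CoherentMassExclusion n K η := by
  intro P
  dsimp only
  intro hP ha hb hd he h0 hmin hmass
  have h7 : (0 : ℝ) < 7 / 10 := by norm_num
  obtain ⟨hΦI, hΦ0⟩ := hΦ P hP ha hb
  obtain ⟨R₇, R₈, R₉, hd'⟩ := hd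
  have happr : ∀ᵐ μ ∂P, ApprM μ R₇ R₈ R₉ := hd'.mono fun μ hμ => hμ
  have hnash : ∀ᵐ μ ∂P, NashM μ := he.mono fun μ hμ => hμ
  have hg : ∀ᵐ μ ∂P, G μ := hG P hP ha hb hmin
  have hfl : ∀ i < n, ∀ᵐ μ ∂P, μ ∈ K i → eStar + mK i ≤ rootEnergy lennardJones μ + Φ μ := fun i hi => by
    filter_upwards [ha, hnash, hg, happr] with μ hμ hN hGμ hT hμi using hfloorG i hi μ hμ hN hGμ ⟨R₇, R₈, R₉, hT⟩ hμi
  have hcp : ∀ᵐ μ ∂P, μ ∉ (⋃ i ∈ Finset.range n, K i) → eStar - rootEnergy lennardJones μ - Φ μ ≤ D := by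
    filter_upwards [ha, hnash, hg, happr] with μ hμ hN hGμ hT hμU using hcapG μ hμ hN hGμ ⟨R₇, R₈, R₉, hT⟩ hμU
  have hlt : eStar < ∫ μ, rootEnergy lennardJones μ ∂P :=
    lt_integral_rootEnergy_of_massLedger h7 ha hΦI hΦ0 hK hm0 hD hm hfl hcp (lt_of_lt_of_le hmass hη)
  exact absurd hmin (not_le.2 hlt)

/-- ★★ **THE REACH THEOREM IN SYMMETRIC CURRENCY, `G`-TYPED SLOTS** ((473) transport identity `transported_eq_symAvgEnergy` + null ledger
`symShare_nullLedger`): row floors `e⋆ + m_i ≤ symAvgEnergy r μ` and the off-row cap `e⋆ − symAvgEnergy r μ ≤ D` need only hold at rooted `7/10`-hard-core,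
Nash, `G`, textured configurations. [new: junction] -/
theorem coherentMassExclusion_of_symAvg_typed
    (hG : ∀ P : Measure (Measure E3), IsProbabilityMeasure P → (∀ᵐ μ ∂P, IsRootedHardCore (7 / 10) μ) → IsPointStationaryLaw P →
      (∫ μ, rootEnergy lennardJones μ ∂P) ≤ (⨅ Q : PeriodicConfiguration 3, Q.energyPerParticle lennardJones) → ∀ᵐ μ ∂P, G μ)
    {r : ℝ} (hr : 0 < r) (n : ℕ) (K : ℕ → Set (MeasureTheory.Measure (EuclideanSpace ℝ (Fin 3))))
    (hK : ∀ i, MeasurableSet (K i)) (mK : ℕ → ℝ)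
    (hfloorG : ∀ i < n, ∀ μ : Measure E3, IsRootedHardCore (7 / 10) μ → NashM μ → G μ → (∃ R₇ R₈ R₉ : ℝ, ApprM μ R₇ R₈ R₉) →
      μ ∈ K i → eStar + mK i ≤ symAvgEnergy r μ)
    {m D : ℝ} (hm0 : 0 < m) (hD : 0 ≤ D) (hm : ∀ i < n, m ≤ mK i)
    (hcapG : ∀ μ : Measure E3, IsRootedHardCore (7 / 10) μ → NashM μ → G μ → (∃ R₇ R₈ R₉ : ℝ, ApprM μ R₇ R₈ R₉) →
      μ ∉ (⋃ i ∈ Finset.range n, K i) → eStar - symAvgEnergy r μ ≤ D)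
    {η : ℝ} (hη : η ≤ reach m D) : CoherentMassExclusion n K η := by
  obtain ⟨H, hHm, hH⟩ := exists_measurable_rootEnergy_surrogate (-(250 / 12 * (10 / 7) ^ 6))
  refine coherentMassExclusion_of_floorsL_typed G hG n K hK mK (net (symShare r H) fun _ _ => 0) (symShare_nullLedger hr hHm hH)
    (fun i hi μ hμ hN hGμ hT hμi => ?_) hm0 hD hm (fun μ hμ hN hGμ hT hμU => ?_) hη
  · rw [transported_eq_symAvgEnergy hr hH hμ]
    exact hfloorG i hi μ hμ hN hGμ hT hμi
  · rw [sub_sub, transported_eq_symAvgEnergy hr hH hμ]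
    exact hcapG μ hμ hN hGμ hT hμU

/-- ★ JUNCTION: `G`-typed symmetric-currency floors + cap + A(η) (`η ≤ reach m D`) ⟹ the crux ((404) `aperiodicFrustratedLawGap_of_massSplit`). [new: junction] -/
theorem aperiodicFrustratedLawGap_of_offAtlasMassGap_symAvg_typed
    (hG : ∀ P : Measure (Measure E3), IsProbabilityMeasure P → (∀ᵐ μ ∂P, IsRootedHardCore (7 / 10) μ) → IsPointStationaryLaw P →
      (∫ μ, rootEnergy lennardJones μ ∂P) ≤ (⨅ Q : PeriodicConfiguration 3, Q.energyPerParticle lennardJones) → ∀ᵐ μ ∂P, G μ)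
    {r : ℝ} (hr : 0 < r) (n : ℕ) (K : ℕ → Set (MeasureTheory.Measure (EuclideanSpace ℝ (Fin 3))))
    (hK : ∀ i, MeasurableSet (K i)) (mK : ℕ → ℝ)
    (hfloorG : ∀ i < n, ∀ μ : Measure E3, IsRootedHardCore (7 / 10) μ → NashM μ → G μ → (∃ R₇ R₈ R₉ : ℝ, ApprM μ R₇ R₈ R₉) →
      μ ∈ K i → eStar + mK i ≤ symAvgEnergy r μ)
    {m D : ℝ} (hm0 : 0 < m) (hD : 0 ≤ D) (hm : ∀ i < n, m ≤ mK i)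
    (hcapG : ∀ μ : Measure E3, IsRootedHardCore (7 / 10) μ → NashM μ → G μ → (∃ R₇ R₈ R₉ : ℝ, ApprM μ R₇ R₈ R₉) →
      μ ∉ (⋃ i ∈ Finset.range n, K i) → eStar - symAvgEnergy r μ ≤ D)
    {η : ℝ} (hη : η ≤ reach m D) (hA : OffAtlasMassGap n K η) :
    Summit.AtomisticToContinuum.Crystallization.Theses.FrustratedLawDichotomy.AperiodicFrustratedLawGap :=
  aperiodicFrustratedLawGap_of_massSplit n K η (coherentMassExclusion_of_symAvg_typed G hG hr n K hK mK hfloorG hm0 hD hm hcapG hη) hA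

/-- ★★ **THE `G`-TYPED STRICT DOOR (A-free, with rows).**  Row floors at rooted hard-core, Nash, `G`, textured configurations (margins `≥ m > 0`) and a STRICT
gap `e⋆ + g ≤ symAvgEnergy r μ` (`g > 0`) at every rooted hard-core, Nash, `G`, textured configuration outside the rows prove the crux outright
((478) `aperiodicFrustratedLawGap_of_texturedSymGap` proof verbatim: the complement becomes a row, the cap is vacuous, `reach = 1`, A(1) trivial). [new: junction] -/
theorem aperiodicFrustratedLawGap_of_typedSymGap
    (hG : ∀ P : Measure (Measure E3), IsProbabilityMeasure P → (∀ᵐ μ ∂P, IsRootedHardCore (7 / 10) μ) → IsPointStationaryLaw P →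
      (∫ μ, rootEnergy lennardJones μ ∂P) ≤ (⨅ Q : PeriodicConfiguration 3, Q.energyPerParticle lennardJones) → ∀ᵐ μ ∂P, G μ)
    {r : ℝ} (hr : 0 < r) (n : ℕ) (K : ℕ → Set (MeasureTheory.Measure (EuclideanSpace ℝ (Fin 3))))
    (hK : ∀ i, MeasurableSet (K i)) (mK : ℕ → ℝ)
    (hfloorG : ∀ i < n, ∀ μ : Measure E3, IsRootedHardCore (7 / 10) μ → NashM μ → G μ → (∃ R₇ R₈ R₉ : ℝ, ApprM μ R₇ R₈ R₉) →
      μ ∈ K i → eStar + mK i ≤ symAvgEnergy r μ)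
    {m g : ℝ} (hm0 : 0 < m) (hm : ∀ i < n, m ≤ mK i) (hg : 0 < g)
    (hgapG : ∀ μ : Measure E3, IsRootedHardCore (7 / 10) μ → NashM μ → G μ → (∃ R₇ R₈ R₉ : ℝ, ApprM μ R₇ R₈ R₉) →
      μ ∉ (⋃ i ∈ Finset.range n, K i) → eStar + g ≤ symAvgEnergy r μ) :
    Summit.AtomisticToContinuum.Crystallization.Theses.FrustratedLawDichotomy.AperiodicFrustratedLawGap := by
  have hU := iUnion_extendRow_eq_univ n K
  have hF : CoherentMassExclusion (n + 1) (extendRow n K) 1 := by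
    refine coherentMassExclusion_of_symAvg_typed G hG hr (n + 1) (extendRow n K) (measurableSet_extendRow hK) (extendMargin n mK g)
      (fun i hi μ hμ hN hGμ hT hμi => ?_) (m := min m g) (D := 0) (lt_min hm0 hg) le_rfl (fun i hi => ?_) (fun μ hμ hN hGμ hT hμU => ?_) (η := 1) ?_
    · by_cases hi' : i < n
      · unfold extendRow at hμi; unfold extendMargin; rw [if_pos hi'] at hμi ⊢
        exact hfloorG i hi' μ hμ hN hGμ hT hμi
      · have hin : i = n := by omega
        subst hin
        unfold extendRow at hμi; unfold extendMargin; rw [if_neg (lt_irrefl i)] at hμi ⊢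
        exact hgapG μ hμ hN hGμ hT hμi
    · unfold extendMargin
      by_cases hi' : i < n
      · rw [if_pos hi']; exact (min_le_left _ _).trans (hm i hi')
      · rw [if_neg hi']; exact min_le_right _ _
    · exact absurd (eq_univ_iff_forall.mp hU μ) hμU
    · unfold reach
      rw [add_zero, div_self (lt_min hm0 hg).ne']
  have hA : OffAtlasMassGap (n + 1) (extendRow n K) 1 := by
    unfold OffAtlasMassGap
    refine noAdmissibleMinimiserWith_of_forall_not fun P hP => ?_
    have hP' : (1 : ℝ) ≤ P.real (⋃ i ∈ Finset.range (n + 1), extendRow n K i)ᶜ := hP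
    rw [hU, compl_univ, measureReal_empty] at hP'
    exact absurd hP' (by norm_num)
  exact aperiodicFrustratedLawGap_of_massSplit (n + 1) (extendRow n K) 1 hF hA

/-- ★ **THE `G`-TYPED LOCAL GAP CLOSES THE CRUX** (row-free): `e⋆ + g ≤ symAvgEnergy r μ` at every rooted `7/10`-hard-core, Nash, `G`, textured `μ`,
for some `r > 0`, `g > 0` ⟹ `AperiodicFrustratedLawGap`. [new: junction] -/
theorem aperiodicFrustratedLawGap_of_typedLocalGap
    (hG : ∀ P : Measure (Measure E3), IsProbabilityMeasure P → (∀ᵐ μ ∂P, IsRootedHardCore (7 / 10) μ) → IsPointStationaryLaw P →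
      (∫ μ, rootEnergy lennardJones μ ∂P) ≤ (⨅ Q : PeriodicConfiguration 3, Q.energyPerParticle lennardJones) → ∀ᵐ μ ∂P, G μ)
    {r : ℝ} (hr : 0 < r) {g : ℝ} (hg : 0 < g)
    (hLFI : ∀ μ : Measure E3, IsRootedHardCore (7 / 10) μ → NashM μ → G μ → (∃ R₇ R₈ R₉ : ℝ, ApprM μ R₇ R₈ R₉) → eStar + g ≤ symAvgEnergy r μ) :
    Summit.AtomisticToContinuum.Crystallization.Theses.FrustratedLawDichotomy.AperiodicFrustratedLawGap :=
  aperiodicFrustratedLawGap_of_typedSymGap G hG hr 0 (fun _ => ∅) (fun _ => MeasurableSet.empty) (fun _ => g)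
    (fun i hi => absurd hi (Nat.not_lt_zero i)) hg (fun i hi => absurd hi (Nat.not_lt_zero i)) hg
    (fun μ hμ hN hGμ hT _ => hLFI μ hμ hN hGμ hT)

/-- ★ **THE `G`-TYPED NEAR / FAR DOOR** ((480) geography: excluded middle on `NearAffine ε₁ ρ μ`, gap `min gN gF`). [new: junction] -/
theorem aperiodicFrustratedLawGap_of_typedLocalGap_nearFar
    (hG : ∀ P : Measure (Measure E3), IsProbabilityMeasure P → (∀ᵐ μ ∂P, IsRootedHardCore (7 / 10) μ) → IsPointStationaryLaw P →
      (∫ μ, rootEnergy lennardJones μ ∂P) ≤ (⨅ Q : PeriodicConfiguration 3, Q.energyPerParticle lennardJones) → ∀ᵐ μ ∂P, G μ)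
    {r : ℝ} (hr : 0 < r) (ε₁ ρ : ℝ) {gN gF : ℝ} (hgN : 0 < gN) (hgF : 0 < gF)
    (hnear : ∀ μ : Measure E3, IsRootedHardCore (7 / 10) μ → NashM μ → G μ → (∃ R₇ R₈ R₉ : ℝ, ApprM μ R₇ R₈ R₉) → NearAffine ε₁ ρ μ →
      eStar + gN ≤ symAvgEnergy r μ)
    (hfar : ∀ μ : Measure E3, IsRootedHardCore (7 / 10) μ → NashM μ → G μ → (∃ R₇ R₈ R₉ : ℝ, ApprM μ R₇ R₈ R₉) → ¬ NearAffine ε₁ ρ μ →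
      eStar + gF ≤ symAvgEnergy r μ) :
    Summit.AtomisticToContinuum.Crystallization.Theses.FrustratedLawDichotomy.AperiodicFrustratedLawGap := by
  refine aperiodicFrustratedLawGap_of_typedLocalGap G hG hr (lt_min hgN hgF) fun μ hμ hN hGμ hT => ?_
  by_cases h : NearAffine ε₁ ρ μ
  · exact (add_le_add_right (min_le_left gN gF) eStar).trans (hnear μ hμ hN hGμ hT h)
  · exact (add_le_add_right (min_le_right gN gF) eStar).trans (hfar μ hμ hN hGμ hT h)

/-- ★ **LAW LEVEL: every regime of (404) may assume «almost surely `G`» for free.**  `NoAdmissibleMinimiserWith (X ∧ a.s. G) ⟹ NoAdmissibleMinimiserWith X`.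
[new: junction] -/
theorem noAdmissibleMinimiserWith_of_aeTyped
    (hG : ∀ P : Measure (Measure E3), IsProbabilityMeasure P → (∀ᵐ μ ∂P, IsRootedHardCore (7 / 10) μ) → IsPointStationaryLaw P →
      (∫ μ, rootEnergy lennardJones μ ∂P) ≤ (⨅ Q : PeriodicConfiguration 3, Q.energyPerParticle lennardJones) → ∀ᵐ μ ∂P, G μ)
    {X : Measure (Measure E3) → Prop} (h : NoAdmissibleMinimiserWith fun P => X P ∧ ∀ᵐ μ ∂P, G μ) :
    NoAdmissibleMinimiserWith X := by
  intro P
  have h' := h P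
  dsimp only at h' ⊢
  intro hP ha hb hd he h0 hmin hX
  exact h' hP ha hb hd he h0 hmin ⟨hX, hG P hP ha hb hmin⟩

end Typed

/-! ## §2. ★★ The instance of record: `G := e⋆-μGSC` (item 27073's name-free clause, verbatim) -/

/-- ★ **ADMISSIBLE MINIMISING LAWS ARE ALMOST SURELY `MuGM`** (= e⋆-μGSC atom set, (16) `…RecurrentMemberDefs.MuGM`): item 27073's door
`…GrainCoreNetworkSplitMuEquilibriumDoor.muEquilibriumDoor_holds` (`…EquilibriumInLaw.stub_equilibriumInLaw` ∘ `unimodularEnergyLowerBound_proof`) at hard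
core `7/10`, read through `Iff.rfl` (`muGM_iff_clause` below: the door's name-free clause IS `MuGM μ`). [tree: 27073] -/
theorem ae_muGM_of_minimising' :
    ∀ P : Measure (Measure E3), IsProbabilityMeasure P → (∀ᵐ μ ∂P, IsRootedHardCore (7 / 10) μ) → IsPointStationaryLaw P →
      (∫ μ, rootEnergy lennardJones μ ∂P) ≤ (⨅ Q : PeriodicConfiguration 3, Q.energyPerParticle lennardJones) → ∀ᵐ μ ∂P, MuGM μ :=
  fun P hP ha hb hmin => (muEquilibriumDoor_holds (7 / 10) (by norm_num) P hP ha hb hmin).mono fun _ hμ => hμ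

/-- ★ **ADMISSIBLE MINIMISING LAWS ARE ALMOST SURELY e⋆-μGSC** — the hypothesis `hG` of §1 for the μGSC clause, i.e. item 27073's name-free clause
verbatim (the door `muEquilibriumDoor_holds (7/10)` BY NAME). [tree: 27073] -/
theorem ae_muGSC_of_minimising :
    ∀ P : Measure (Measure E3), IsProbabilityMeasure P → (∀ᵐ μ ∂P, IsRootedHardCore (7 / 10) μ) → IsPointStationaryLaw P →
      (∫ μ, rootEnergy lennardJones μ ∂P) ≤ (⨅ Q : PeriodicConfiguration 3, Q.energyPerParticle lennardJones) →
      ∀ᵐ μ ∂P, ((∀ r : EuclideanSpace ℝ (Fin 3), Summable fun y : ↥({p : EuclideanSpace ℝ (Fin 3) | μ {p} ≠ 0}) => Literature.MathematicalPhysics.StatisticalMechanics.lennardJones (dist r y)) ∧ ∀ (n : ℕ) (xf : Fin n → EuclideanSpace ℝ (Fin 3)), Function.Injective xf → Set.range xf ⊆ {p : EuclideanSpace ℝ (Fin 3) | μ {p} ≠ 0} → ∀ (k : ℕ) (R : Fin k → EuclideanSpace ℝ (Fin 3)), Function.Injective R → Disjoint (Set.range R) ({p : EuclideanSpace ℝ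 (Fin 3) | μ {p} ≠ 0} \ Set.range xf) → Literature.MathematicalPhysics.StatisticalMechanics.interactionEnergy Literature.MathematicalPhysics.StatisticalMechanics.lennardJones xf + (∑ i, ∑' y : ↥({p : EuclideanSpace ℝ (Fin 3) | μ {p} ≠ 0} \ Set.range xf), Literature.MathematicalPhysics.StatisticalMechanics.lennardJones (dist (xf i) y)) - (⨅ Q : Literature.MathematicalPhysics.StatisticalMechanics.PeriodicConfiguration 3, Q.energyPerParticle Literature.MathematicalPhysics.StatisticalMechanics.lennardJones) * n ≤ Literature.MathematicalPhysics.StatisticalMechanics.interactionEnergy Literature.MathematicalPhysics.StatisticalMechanics.lennardJones R + (∑ i, ∑' y : ↥({p : EuclideanSpace ℝ (Fin 3) | μ {p} ≠ 0} \ Set.range xf), Literature.MathematicalPhysics.StatisticalMechanics.lennardJones (dist (R i) y)) - (⨅ Q : Literature.MathematicalPhysics.StatisticalMechanics.PeriodicConfiguration 3, Q.energyPerParticle Literature.MathematicalPhysics.StatisticalMechanics.lennardJones) * k) :=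
  fun P hP ha hb hmin => (ae_muGM_of_minimising' P hP ha hb hmin).mono fun _ hμ => hμ

/-- ★★★ **THE GSC-TYPED LOCAL GAP CLOSES THE CRUX** (r1959 (D), the K2″ currency of record):
  every rooted `7/10`-hard-core configuration whose atom set is an e⋆-μGSC (no finite modification `xf ↦ R` lowers `U + I − e⋆·#`, 27073's clause verbatim) and
  which is TEXTURED (`∃ R₇ R₈ R₉, ApprM μ R₇ R₈ R₉`) has `e⋆ + g ≤ symAvgEnergy r μ`, for some `r > 0`, `g > 0`
⟹ `AperiodicFrustratedLawGap`.  No Nash antecedent (single-site Nash is the `n = k = 1` case of the clause); no positive-field halo, no pressurised matrix is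
in the domain (`binding ≤ e⋆ < 0` at every atom).  Law-free and single-configuration. [new: junction] -/
theorem aperiodicFrustratedLawGap_of_gscLocalGap {r : ℝ} (hr : 0 < r) {g : ℝ} (hg : 0 < g)
    (hgap : ∀ μ : Measure E3, IsRootedHardCore (7 / 10) μ → ((∀ r : EuclideanSpace ℝ (Fin 3), Summable fun y : ↥({p : EuclideanSpace ℝ (Fin 3) | μ {p} ≠ 0}) => Literature.MathematicalPhysics.StatisticalMechanics.lennardJones (dist r y)) ∧ ∀ (n : ℕ) (xf : Fin n → EuclideanSpace ℝ (Fin 3)), Function.Injective xf → Set.range xf ⊆ {p : EuclideanSpace ℝ (Fin 3) | μ {p} ≠ 0} → ∀ (k : ℕ) (R : Fin k → EuclideanSpace ℝ (Fin 3)), Function.Injective R → Disjoint (Set.range R) ({p : EuclideanSpace ℝ (Fin 3) | μ {p} ≠ 0} \ Set.range xf) → Literature.MathematicalPhysics.StatisticalMechanics.interactionEnergy Literature.MathematicalPhysics.StatisticalMechanics.lennardJones xf + (∑ i, ∑' y : ↥({p : EuclideanSpace ℝ (Fin 3) | μ {p} ≠ 0} \ Set.range xf), Literature.MathematicalPhysics.StatisticalMechanics.lennardJones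 (dist (xf i) y)) - (⨅ Q : Literature.MathematicalPhysics.StatisticalMechanics.PeriodicConfiguration 3, Q.energyPerParticle Literature.MathematicalPhysics.StatisticalMechanics.lennardJones) * n ≤ Literature.MathematicalPhysics.StatisticalMechanics.interactionEnergy Literature.MathematicalPhysics.StatisticalMechanics.lennardJones R + (∑ i, ∑' y : ↥({p : EuclideanSpace ℝ (Fin 3) | μ {p} ≠ 0} \ Set.range xf), Literature.MathematicalPhysics.StatisticalMechanics.lennardJones (dist (R i) y)) - (⨅ Q : Literature.MathematicalPhysics.StatisticalMechanics.PeriodicConfiguration 3, Q.energyPerParticle Literature.MathematicalPhysics.StatisticalMechanics.lennardJones) * k) → (∃ R₇ R₈ R₉ : ℝ, ApprM μ R₇ R₈ R₉) → eStar + g ≤ symAvgEnergy r μ) :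
    Summit.AtomisticToContinuum.Crystallization.Theses.FrustratedLawDichotomy.AperiodicFrustratedLawGap :=
  aperiodicFrustratedLawGap_of_typedLocalGap _ ae_muGSC_of_minimising hr hg fun μ hμ _ hGμ hT => hgap μ hμ hGμ hT

/-- ★★ **THE GSC-TYPED STRICT DOOR WITH CERTIFIED ROWS**: symmetric-currency floors on the rows `K i` (margins `≥ m > 0`) and the strict gap `g > 0` off the
rows, both at rooted `7/10`-hard-core, e⋆-μGSC, textured configurations ⟹ `AperiodicFrustratedLawGap`. [new: junction] -/
theorem aperiodicFrustratedLawGap_of_gscSymGap {r : ℝ} (hr : 0 < r) (n : ℕ) (K : ℕ → Set (MeasureTheory.Measure (EuclideanSpace ℝ (Fin 3))))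
    (hK : ∀ i, MeasurableSet (K i)) (mK : ℕ → ℝ)
    (hfloor : ∀ i < n, ∀ μ : Measure E3, IsRootedHardCore (7 / 10) μ → ((∀ r : EuclideanSpace ℝ (Fin 3), Summable fun y : ↥({p : EuclideanSpace ℝ (Fin 3) | μ {p} ≠ 0}) => Literature.MathematicalPhysics.StatisticalMechanics.lennardJones (dist r y)) ∧ ∀ (n : ℕ) (xf : Fin n → EuclideanSpace ℝ (Fin 3)), Function.Injective xf → Set.range xf ⊆ {p : EuclideanSpace ℝ (Fin 3) | μ {p} ≠ 0} → ∀ (k : ℕ) (R : Fin k → EuclideanSpace ℝ (Fin 3)), Function.Injective R → Disjoint (Set.range R) ({p : EuclideanSpace ℝ (Fin 3) | μ {p} ≠ 0} \ Set.range xf) → Literature.MathematicalPhysics.StatisticalMechanics.interactionEnergy Literature.MathematicalPhysics.StatisticalMechanics.lennardJones xf + (∑ i, ∑' y : ↥({p : EuclideanSpace ℝ (Fin 3) | μ {p} ≠ 0} \ Set.range xf), Literature.MathematicalPhysics.StatisticalMechanics.lennardJones (dist (xf i) y)) - (⨅ Q : Literature.MathematicalPhysics.StatisticalMechanics.PeriodicConfiguration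 3, Q.energyPerParticle Literature.MathematicalPhysics.StatisticalMechanics.lennardJones) * n ≤ Literature.MathematicalPhysics.StatisticalMechanics.interactionEnergy Literature.MathematicalPhysics.StatisticalMechanics.lennardJones R + (∑ i, ∑' y : ↥({p : EuclideanSpace ℝ (Fin 3) | μ {p} ≠ 0} \ Set.range xf), Literature.MathematicalPhysics.StatisticalMechanics.lennardJones (dist (R i) y)) - (⨅ Q : Literature.MathematicalPhysics.StatisticalMechanics.PeriodicConfiguration 3, Q.energyPerParticle Literature.MathematicalPhysics.StatisticalMechanics.lennardJones) * k) → (∃ R₇ R₈ R₉ : ℝ, ApprM μ R₇ R₈ R₉) → μ ∈ K i → eStar + mK i ≤ symAvgEnergy r μ)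
    {m g : ℝ} (hm0 : 0 < m) (hm : ∀ i < n, m ≤ mK i) (hg : 0 < g)
    (hgap : ∀ μ : Measure E3, IsRootedHardCore (7 / 10) μ → ((∀ r : EuclideanSpace ℝ (Fin 3), Summable fun y : ↥({p : EuclideanSpace ℝ (Fin 3) | μ {p} ≠ 0}) => Literature.MathematicalPhysics.StatisticalMechanics.lennardJones (dist r y)) ∧ ∀ (n : ℕ) (xf : Fin n → EuclideanSpace ℝ (Fin 3)), Function.Injective xf → Set.range xf ⊆ {p : EuclideanSpace ℝ (Fin 3) | μ {p} ≠ 0} → ∀ (k : ℕ) (R : Fin k → EuclideanSpace ℝ (Fin 3)), Function.Injective R → Disjoint (Set.range R) ({p : EuclideanSpace ℝ (Fin 3) | μ {p} ≠ 0} \ Set.range xf) → Literature.MathematicalPhysics.StatisticalMechanics.interactionEnergy Literature.MathematicalPhysics.StatisticalMechanics.lennardJones xf + (∑ i, ∑' y : ↥({p : EuclideanSpace ℝ (Fin 3) | μ {p} ≠ 0} \ Set.range xf), Literature.MathematicalPhysics.StatisticalMechanics.lennardJones (dist (xf i) y)) - (⨅ Q : Literature.MathematicalPhysics.StatisticalMechanics.PeriodicConfiguration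 3, Q.energyPerParticle Literature.MathematicalPhysics.StatisticalMechanics.lennardJones) * n ≤ Literature.MathematicalPhysics.StatisticalMechanics.interactionEnergy Literature.MathematicalPhysics.StatisticalMechanics.lennardJones R + (∑ i, ∑' y : ↥({p : EuclideanSpace ℝ (Fin 3) | μ {p} ≠ 0} \ Set.range xf), Literature.MathematicalPhysics.StatisticalMechanics.lennardJones (dist (R i) y)) - (⨅ Q : Literature.MathematicalPhysics.StatisticalMechanics.PeriodicConfiguration 3, Q.energyPerParticle Literature.MathematicalPhysics.StatisticalMechanics.lennardJones) * k) → (∃ R₇ R₈ R₉ : ℝ, ApprM μ R₇ R₈ R₉) → μ ∉ (⋃ i ∈ Finset.range n, K i) → eStar + g ≤ symAvgEnergy r μ) :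
    Summit.AtomisticToContinuum.Crystallization.Theses.FrustratedLawDichotomy.AperiodicFrustratedLawGap :=
  aperiodicFrustratedLawGap_of_typedSymGap _ ae_muGSC_of_minimising hr n K hK mK (fun i hi μ hμ _ hGμ hT hμi => hfloor i hi μ hμ hGμ hT hμi)
    hm0 hm hg (fun μ hμ _ hGμ hT hμU => hgap μ hμ hGμ hT hμU)

/-- ★★ **THE GSC-TYPED NEAR / FAR DOOR** ((480) geography over the class of record): the gap split by `NearAffine ε₁ ρ μ` into a near part (`gN > 0`) and a
far part (`gF > 0`), both at rooted `7/10`-hard-core, e⋆-μGSC, textured configurations ⟹ `AperiodicFrustratedLawGap`. [new: junction] -/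
theorem aperiodicFrustratedLawGap_of_gscLocalGap_nearFar {r : ℝ} (hr : 0 < r) (ε₁ ρ : ℝ) {gN gF : ℝ} (hgN : 0 < gN) (hgF : 0 < gF)
    (hnear : ∀ μ : Measure E3, IsRootedHardCore (7 / 10) μ → ((∀ r : EuclideanSpace ℝ (Fin 3), Summable fun y : ↥({p : EuclideanSpace ℝ (Fin 3) | μ {p} ≠ 0}) => Literature.MathematicalPhysics.StatisticalMechanics.lennardJones (dist r y)) ∧ ∀ (n : ℕ) (xf : Fin n → EuclideanSpace ℝ (Fin 3)), Function.Injective xf → Set.range xf ⊆ {p : EuclideanSpace ℝ (Fin 3) | μ {p} ≠ 0} → ∀ (k : ℕ) (R : Fin k → EuclideanSpace ℝ (Fin 3)), Function.Injective R → Disjoint (Set.range R) ({p : EuclideanSpace ℝ (Fin 3) | μ {p} ≠ 0} \ Set.range xf) → Literature.MathematicalPhysics.StatisticalMechanics.interactionEnergy Literature.MathematicalPhysics.StatisticalMechanics.lennardJones xf + (∑ i, ∑' y : ↥({p : EuclideanSpace ℝ (Fin 3) | μ {p} ≠ 0} \ Set.range xf), Literature.MathematicalPhysics.StatisticalMechanics.lennardJones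 (dist (xf i) y)) - (⨅ Q : Literature.MathematicalPhysics.StatisticalMechanics.PeriodicConfiguration 3, Q.energyPerParticle Literature.MathematicalPhysics.StatisticalMechanics.lennardJones) * n ≤ Literature.MathematicalPhysics.StatisticalMechanics.interactionEnergy Literature.MathematicalPhysics.StatisticalMechanics.lennardJones R + (∑ i, ∑' y : ↥({p : EuclideanSpace ℝ (Fin 3) | μ {p} ≠ 0} \ Set.range xf), Literature.MathematicalPhysics.StatisticalMechanics.lennardJones (dist (R i) y)) - (⨅ Q : Literature.MathematicalPhysics.StatisticalMechanics.PeriodicConfiguration 3, Q.energyPerParticle Literature.MathematicalPhysics.StatisticalMechanics.lennardJones) * k) → (∃ R₇ R₈ R₉ : ℝ, ApprM μ R₇ R₈ R₉) → NearAffine ε₁ ρ μ → eStar + gN ≤ symAvgEnergy r μ)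
    (hfar : ∀ μ : Measure E3, IsRootedHardCore (7 / 10) μ → ((∀ r : EuclideanSpace ℝ (Fin 3), Summable fun y : ↥({p : EuclideanSpace ℝ (Fin 3) | μ {p} ≠ 0}) => Literature.MathematicalPhysics.StatisticalMechanics.lennardJones (dist r y)) ∧ ∀ (n : ℕ) (xf : Fin n → EuclideanSpace ℝ (Fin 3)), Function.Injective xf → Set.range xf ⊆ {p : EuclideanSpace ℝ (Fin 3) | μ {p} ≠ 0} → ∀ (k : ℕ) (R : Fin k → EuclideanSpace ℝ (Fin 3)), Function.Injective R → Disjoint (Set.range R) ({p : EuclideanSpace ℝ (Fin 3) | μ {p} ≠ 0} \ Set.range xf) → Literature.MathematicalPhysics.StatisticalMechanics.interactionEnergy Literature.MathematicalPhysics.StatisticalMechanics.lennardJones xf + (∑ i, ∑' y : ↥({p : EuclideanSpace ℝ (Fin 3) | μ {p} ≠ 0} \ Set.range xf), Literature.MathematicalPhysics.StatisticalMechanics.lennardJones (dist (xf i) y)) - (⨅ Q : Literature.MathematicalPhysics.StatisticalMechanics.PeriodicConfiguration 3, Q.energyPerParticle Literature.MathematicalPhysics.StatisticalMechanics.lennardJones)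 * n ≤ Literature.MathematicalPhysics.StatisticalMechanics.interactionEnergy Literature.MathematicalPhysics.StatisticalMechanics.lennardJones R + (∑ i, ∑' y : ↥({p : EuclideanSpace ℝ (Fin 3) | μ {p} ≠ 0} \ Set.range xf), Literature.MathematicalPhysics.StatisticalMechanics.lennardJones (dist (R i) y)) - (⨅ Q : Literature.MathematicalPhysics.StatisticalMechanics.PeriodicConfiguration 3, Q.energyPerParticle Literature.MathematicalPhysics.StatisticalMechanics.lennardJones) * k) → (∃ R₇ R₈ R₉ : ℝ, ApprM μ R₇ R₈ R₉) → ¬ NearAffine ε₁ ρ μ → eStar + gF ≤ symAvgEnergy r μ) :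
    Summit.AtomisticToContinuum.Crystallization.Theses.FrustratedLawDichotomy.AperiodicFrustratedLawGap :=
  aperiodicFrustratedLawGap_of_typedLocalGap_nearFar _ ae_muGSC_of_minimising hr ε₁ ρ hgN hgF
    (fun μ hμ _ hGμ hT hN => hnear μ hμ hGμ hT hN) (fun μ hμ _ hGμ hT hF => hfar μ hμ hGμ hT hF)

/-- ★ **LAW LEVEL: every regime may assume «a.s. e⋆-μGSC» for free.** [new: junction] -/
theorem noAdmissibleMinimiserWith_of_aeGSC {X : Measure (Measure E3) → Prop}
    (h : NoAdmissibleMinimiserWith fun P => X P ∧ ∀ᵐ μ ∂P, ((∀ r : EuclideanSpace ℝ (Fin 3), Summable fun y : ↥({p : EuclideanSpace ℝ (Fin 3) | μ {p} ≠ 0}) => Literature.MathematicalPhysics.StatisticalMechanics.lennardJones (dist r y)) ∧ ∀ (n : ℕ) (xf : Fin n → EuclideanSpace ℝ (Fin 3)), Function.Injective xf → Set.range xf ⊆ {p : EuclideanSpace ℝ (Fin 3) | μ {p} ≠ 0} → ∀ (k : ℕ) (R : Fin k → EuclideanSpace ℝ (Fin 3)), Function.Injective R → Disjoint (Set.range R)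 ({p : EuclideanSpace ℝ (Fin 3) | μ {p} ≠ 0} \ Set.range xf) → Literature.MathematicalPhysics.StatisticalMechanics.interactionEnergy Literature.MathematicalPhysics.StatisticalMechanics.lennardJones xf + (∑ i, ∑' y : ↥({p : EuclideanSpace ℝ (Fin 3) | μ {p} ≠ 0} \ Set.range xf), Literature.MathematicalPhysics.StatisticalMechanics.lennardJones (dist (xf i) y)) - (⨅ Q : Literature.MathematicalPhysics.StatisticalMechanics.PeriodicConfiguration 3, Q.energyPerParticle Literature.MathematicalPhysics.StatisticalMechanics.lennardJones) * n ≤ Literature.MathematicalPhysics.StatisticalMechanics.interactionEnergy Literature.MathematicalPhysics.StatisticalMechanics.lennardJones R + (∑ i, ∑' y : ↥({p : EuclideanSpace ℝ (Fin 3) | μ {p} ≠ 0} \ Set.range xf), Literature.MathematicalPhysics.StatisticalMechanics.lennardJones (dist (R i) y)) - (⨅ Q : Literature.MathematicalPhysics.StatisticalMechanics.PeriodicConfiguration 3, Q.energyPerParticle Literature.MathematicalPhysics.StatisticalMechanics.lennardJones) * k)) :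
    NoAdmissibleMinimiserWith X :=
  noAdmissibleMinimiserWith_of_aeTyped _ ae_muGSC_of_minimising h

/-- ★ **#137 COMPOSITION — an invariant split whose two leaves carry the μGSC clause**: for a measurable re-rooting-invariant class `B`, «no admissible
minimising law is a.s. carried by `B` ∧ a.s. e⋆-μGSC» and «none is a.s. carried by `Bᶜ` ∧ a.s. e⋆-μGSC» ⟹ `AperiodicFrustratedLawGap`
(#137 `aperiodicFrustratedLawGap_of_invariantSplit` after `noAdmissibleMinimiserWith_of_aeGSC`). [new: junction] -/
theorem aperiodicFrustratedLawGap_of_invariantSplit_gsc (B : Set (Measure E3)) (hB : MeasurableSet B)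
    (hinv : ∀ μ : Measure E3, ∀ p : E3, μ {p} ≠ 0 → (μ ∈ B ↔ Measure.map (fun z : E3 => z - p) μ ∈ B))
    (h₁ : NoAdmissibleMinimiserWith fun P => (∀ᵐ μ ∂P, μ ∈ B) ∧ ∀ᵐ μ ∂P, ((∀ r : EuclideanSpace ℝ (Fin 3), Summable fun y : ↥({p : EuclideanSpace ℝ (Fin 3) | μ {p} ≠ 0}) => Literature.MathematicalPhysics.StatisticalMechanics.lennardJones (dist r y)) ∧ ∀ (n : ℕ) (xf : Fin n → EuclideanSpace ℝ (Fin 3)), Function.Injective xf → Set.range xf ⊆ {p : EuclideanSpace ℝ (Fin 3) | μ {p} ≠ 0} → ∀ (k : ℕ) (R : Fin k → EuclideanSpace ℝ (Fin 3)), Function.Injective R → Disjoint (Set.range R) ({p : EuclideanSpace ℝ (Fin 3) | μ {p} ≠ 0} \ Set.range xf) → Literature.MathematicalPhysics.StatisticalMechanics.interactionEnergy Literature.MathematicalPhysics.StatisticalMechanics.lennardJones xf + (∑ i, ∑' y : ↥({p : EuclideanSpace ℝ (Fin 3) | μ {p} ≠ 0} \ Set.range xf), Literature.MathematicalPhysics.StatisticalMechanics.lennardJones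 (dist (xf i) y)) - (⨅ Q : Literature.MathematicalPhysics.StatisticalMechanics.PeriodicConfiguration 3, Q.energyPerParticle Literature.MathematicalPhysics.StatisticalMechanics.lennardJones) * n ≤ Literature.MathematicalPhysics.StatisticalMechanics.interactionEnergy Literature.MathematicalPhysics.StatisticalMechanics.lennardJones R + (∑ i, ∑' y : ↥({p : EuclideanSpace ℝ (Fin 3) | μ {p} ≠ 0} \ Set.range xf), Literature.MathematicalPhysics.StatisticalMechanics.lennardJones (dist (R i) y)) - (⨅ Q : Literature.MathematicalPhysics.StatisticalMechanics.PeriodicConfiguration 3, Q.energyPerParticle Literature.MathematicalPhysics.StatisticalMechanics.lennardJones) * k))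
    (h₂ : NoAdmissibleMinimiserWith fun P => (∀ᵐ μ ∂P, μ ∈ Bᶜ) ∧ ∀ᵐ μ ∂P, ((∀ r : EuclideanSpace ℝ (Fin 3), Summable fun y : ↥({p : EuclideanSpace ℝ (Fin 3) | μ {p} ≠ 0}) => Literature.MathematicalPhysics.StatisticalMechanics.lennardJones (dist r y)) ∧ ∀ (n : ℕ) (xf : Fin n → EuclideanSpace ℝ (Fin 3)), Function.Injective xf → Set.range xf ⊆ {p : EuclideanSpace ℝ (Fin 3) | μ {p} ≠ 0} → ∀ (k : ℕ) (R : Fin k → EuclideanSpace ℝ (Fin 3)), Function.Injective R → Disjoint (Set.range R) ({p : EuclideanSpace ℝ (Fin 3) | μ {p} ≠ 0} \ Set.range xf) → Literature.MathematicalPhysics.StatisticalMechanics.interactionEnergy Literature.MathematicalPhysics.StatisticalMechanics.lennardJones xf + (∑ i, ∑' y : ↥({p : EuclideanSpace ℝ (Fin 3) | μ {p} ≠ 0} \ Set.range xf), Literature.MathematicalPhysics.StatisticalMechanics.lennardJones (dist (xf i) y)) - (⨅ Q : Literature.MathematicalPhysics.StatisticalMechanics.PeriodicConfiguration 3, Q.energyPerParticle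 Literature.MathematicalPhysics.StatisticalMechanics.lennardJones) * n ≤ Literature.MathematicalPhysics.StatisticalMechanics.interactionEnergy Literature.MathematicalPhysics.StatisticalMechanics.lennardJones R + (∑ i, ∑' y : ↥({p : EuclideanSpace ℝ (Fin 3) | μ {p} ≠ 0} \ Set.range xf), Literature.MathematicalPhysics.StatisticalMechanics.lennardJones (dist (R i) y)) - (⨅ Q : Literature.MathematicalPhysics.StatisticalMechanics.PeriodicConfiguration 3, Q.energyPerParticle Literature.MathematicalPhysics.StatisticalMechanics.lennardJones) * k)) :
    Summit.AtomisticToContinuum.Crystallization.Theses.FrustratedLawDichotomy.AperiodicFrustratedLawGap :=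
  aperiodicFrustratedLawGap_of_invariantSplit B hB hinv (noAdmissibleMinimiserWith_of_aeGSC h₁) (noAdmissibleMinimiserWith_of_aeGSC h₂)

/-! ## §3. The same doors in the route's NAMED vocabulary `MuGM μ` (`= IsMuGSC lennardJones eStar {p | μ {p} ≠ 0}`, (16) `…RecurrentMemberDefs`) -/

/-- The name-free clause of 27073 IS `MuGM μ` (the Literature `IsMuGSC` unfolded at `V = V_LJ`, `μ = e⋆`, `X = ` the atom set), by `Iff.rfl`. [new: bookkeeping] -/
theorem muGM_iff_clause (μ : Measure E3) : MuGM μ ↔ ((∀ r : EuclideanSpace ℝ (Fin 3), Summable fun y : ↥({p : EuclideanSpace ℝ (Fin 3) | μ {p} ≠ 0}) => Literature.MathematicalPhysics.StatisticalMechanics.lennardJones (dist r y)) ∧ ∀ (n : ℕ) (xf : Fin n → EuclideanSpace ℝ (Fin 3)), Function.Injective xf → Set.range xf ⊆ {p : EuclideanSpace ℝ (Fin 3) | μ {p} ≠ 0} → ∀ (k : ℕ) (R : Fin k → EuclideanSpace ℝ (Fin 3)), Function.Injective R → Disjoint (Set.range R) ({p : EuclideanSpace ℝ (Fin 3) | μ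 {p} ≠ 0} \ Set.range xf) → Literature.MathematicalPhysics.StatisticalMechanics.interactionEnergy Literature.MathematicalPhysics.StatisticalMechanics.lennardJones xf + (∑ i, ∑' y : ↥({p : EuclideanSpace ℝ (Fin 3) | μ {p} ≠ 0} \ Set.range xf), Literature.MathematicalPhysics.StatisticalMechanics.lennardJones (dist (xf i) y)) - (⨅ Q : Literature.MathematicalPhysics.StatisticalMechanics.PeriodicConfiguration 3, Q.energyPerParticle Literature.MathematicalPhysics.StatisticalMechanics.lennardJones) * n ≤ Literature.MathematicalPhysics.StatisticalMechanics.interactionEnergy Literature.MathematicalPhysics.StatisticalMechanics.lennardJones R + (∑ i, ∑' y : ↥({p : EuclideanSpace ℝ (Fin 3) | μ {p} ≠ 0} \ Set.range xf), Literature.MathematicalPhysics.StatisticalMechanics.lennardJones (dist (R i) y)) - (⨅ Q : Literature.MathematicalPhysics.StatisticalMechanics.PeriodicConfiguration 3, Q.energyPerParticle Literature.MathematicalPhysics.StatisticalMechanics.lennardJones) * k) :=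
  Iff.rfl

/-- admissible minimising laws are almost surely `MuGM`. [tree: 27073] -/
theorem ae_muGM_of_minimising :
    ∀ P : Measure (Measure E3), IsProbabilityMeasure P → (∀ᵐ μ ∂P, IsRootedHardCore (7 / 10) μ) → IsPointStationaryLaw P →
      (∫ μ, rootEnergy lennardJones μ ∂P) ≤ (⨅ Q : PeriodicConfiguration 3, Q.energyPerParticle lennardJones) → ∀ᵐ μ ∂P, MuGM μ :=
  ae_muGM_of_minimising'

/-- ★★ **THE `MuGM`-TYPED LOCAL GAP CLOSES THE CRUX** (named form of `aperiodicFrustratedLawGap_of_gscLocalGap`): `e⋆ + g ≤ symAvgEnergy r μ` at every rooted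
`7/10`-hard-core, `MuGM`, textured `μ` ⟹ `AperiodicFrustratedLawGap`. [new: junction] -/
theorem aperiodicFrustratedLawGap_of_muGMLocalGap {r : ℝ} (hr : 0 < r) {g : ℝ} (hg : 0 < g)
    (hgap : ∀ μ : Measure E3, IsRootedHardCore (7 / 10) μ → MuGM μ → (∃ R₇ R₈ R₉ : ℝ, ApprM μ R₇ R₈ R₉) → eStar + g ≤ symAvgEnergy r μ) :
    Summit.AtomisticToContinuum.Crystallization.Theses.FrustratedLawDichotomy.AperiodicFrustratedLawGap :=
  aperiodicFrustratedLawGap_of_typedLocalGap _ ae_muGM_of_minimising hr hg fun μ hμ _ hGμ hT => hgap μ hμ hGμ hT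

/-- ★ **THE `MuGM`-TYPED STRICT DOOR WITH CERTIFIED ROWS** (named form of `aperiodicFrustratedLawGap_of_gscSymGap`). [new: junction] -/
theorem aperiodicFrustratedLawGap_of_muGMSymGap {r : ℝ} (hr : 0 < r) (n : ℕ) (K : ℕ → Set (MeasureTheory.Measure (EuclideanSpace ℝ (Fin 3))))
    (hK : ∀ i, MeasurableSet (K i)) (mK : ℕ → ℝ)
    (hfloor : ∀ i < n, ∀ μ : Measure E3, IsRootedHardCore (7 / 10) μ → MuGM μ → (∃ R₇ R₈ R₉ : ℝ, ApprM μ R₇ R₈ R₉) →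
      μ ∈ K i → eStar + mK i ≤ symAvgEnergy r μ)
    {m g : ℝ} (hm0 : 0 < m) (hm : ∀ i < n, m ≤ mK i) (hg : 0 < g)
    (hgap : ∀ μ : Measure E3, IsRootedHardCore (7 / 10) μ → MuGM μ → (∃ R₇ R₈ R₉ : ℝ, ApprM μ R₇ R₈ R₉) →
      μ ∉ (⋃ i ∈ Finset.range n, K i) → eStar + g ≤ symAvgEnergy r μ) :
    Summit.AtomisticToContinuum.Crystallization.Theses.FrustratedLawDichotomy.AperiodicFrustratedLawGap :=
  aperiodicFrustratedLawGap_of_typedSymGap _ ae_muGM_of_minimising hr n K hK mK (fun i hi μ hμ _ hGμ hT hμi => hfloor i hi μ hμ hGμ hT hμi)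
    hm0 hm hg (fun μ hμ _ hGμ hT hμU => hgap μ hμ hGμ hT hμU)

/-- ★ **THE `MuGM`-TYPED NEAR / FAR DOOR** (named form of `aperiodicFrustratedLawGap_of_gscLocalGap_nearFar`). [new: junction] -/
theorem aperiodicFrustratedLawGap_of_muGMLocalGap_nearFar {r : ℝ} (hr : 0 < r) (ε₁ ρ : ℝ) {gN gF : ℝ} (hgN : 0 < gN) (hgF : 0 < gF)
    (hnear : ∀ μ : Measure E3, IsRootedHardCore (7 / 10) μ → MuGM μ → (∃ R₇ R₈ R₉ : ℝ, ApprM μ R₇ R₈ R₉) → NearAffine ε₁ ρ μ →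
      eStar + gN ≤ symAvgEnergy r μ)
    (hfar : ∀ μ : Measure E3, IsRootedHardCore (7 / 10) μ → MuGM μ → (∃ R₇ R₈ R₉ : ℝ, ApprM μ R₇ R₈ R₉) → ¬ NearAffine ε₁ ρ μ →
      eStar + gF ≤ symAvgEnergy r μ) :
    Summit.AtomisticToContinuum.Crystallization.Theses.FrustratedLawDichotomy.AperiodicFrustratedLawGap :=
  aperiodicFrustratedLawGap_of_typedLocalGap_nearFar _ ae_muGM_of_minimising hr ε₁ ρ hgN hgF
    (fun μ hμ _ hGμ hT hN => hnear μ hμ hGμ hT hN) (fun μ hμ _ hGμ hT hF => hfar μ hμ hGμ hT hF)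

/-- **USE (the weakening direction, kernel-checked)**: a NashM-class certificate of (478)'s `aperiodicFrustratedLawGap_of_texturedLocalGap` is in particular
a `MuGM`-class certificate once single-site Nash is read off the μGSC clause; conversely the GSC door's hypothesis is WEAKER (fewer configurations to
certify).  Here only the trivial direction is recorded as an `example`: a gap valid at every hard-core textured configuration (no Nash, no μGSC used) feeds
the `MuGM` door. [new: bookkeeping] -/
example {r : ℝ} (hr : 0 < r) {g : ℝ} (hg : 0 < g)
    (hgap : ∀ μ : Measure E3, IsRootedHardCore (7 / 10) μ → (∃ R₇ R₈ R₉ : ℝ, ApprM μ R₇ R₈ R₉) → eStar + g ≤ symAvgEnergy r μ) :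
    Summit.AtomisticToContinuum.Crystallization.Theses.FrustratedLawDichotomy.AperiodicFrustratedLawGap :=
  aperiodicFrustratedLawGap_of_muGMLocalGap hr hg fun μ hμ _ hT => hgap μ hμ hT

/-! ## §4. Finite windows ((481) `…LFIRangeCut`): the [FIN] currency of record at `K := MuGM` (crit-1 g44 r1960 / r1962 amendment of (482)) -/

/-- ★★ **THE GSC-TYPED WINDOW DOOR** (tail discharged, any cut radius `R ≥ 1`): the finite-window inequality [FIN](`MuGM`, r, R, e⋆ + g + tauSharp R) —
(481)'s `TexturedWindowGapOn` read on the class `K := MuGM` — proves `AperiodicFrustratedLawGap` ((481) bridge `texturedLocalGapOn_of_rangeCut` + [TAIL♯]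
`siteTailFloorSharp`, fed into §3's `MuGM` door; the NashM antecedent of [FIN] is harmless). [new: junction] -/
theorem aperiodicFrustratedLawGap_of_gscWindowGap {r R g : ℝ} (hr : 0 < r) (hR : 1 ≤ R) (hg : 0 < g)
    (hW : TexturedWindowGapOn MuGM r R (eStar + g + tauSharp R)) :
    Summit.AtomisticToContinuum.Crystallization.Theses.FrustratedLawDichotomy.AperiodicFrustratedLawGap :=
  aperiodicFrustratedLawGap_of_typedLocalGap _ ae_muGM_of_minimising hr hg fun μ hμ hN hG hT =>
    texturedLocalGapOn_of_rangeCut hr hW (siteTailFloorSharp R hR) μ hμ hN hT hG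

/-- ★★ **THE GSC-TYPED WINDOW DOOR, NEAR / FAR** (independent cut radii and tail budgets): [FIN] on `MuGM ∧ NearAffine ε₁ ρ` at `(R_N, e⋆ + gN + τ_N)` with
[TAIL](R_N, τ_N), and [FIN] on `MuGM ∧ ¬ NearAffine ε₁ ρ` at `(R_F, e⋆ + gF + τ_F)` with [TAIL](R_F, τ_F) ⟹ `AperiodicFrustratedLawGap`. [new: junction] -/
theorem aperiodicFrustratedLawGap_of_gscWindowGap_nearFar {r : ℝ} (hr : 0 < r) (ε₁ ρ : ℝ) {RN RF τN τF gN gF : ℝ} (hgN : 0 < gN) (hgF : 0 < gF)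
    (hWN : TexturedWindowGapOn (fun μ => MuGM μ ∧ NearAffine ε₁ ρ μ) r RN (eStar + gN + τN)) (hTN : SiteTailFloor RN τN)
    (hWF : TexturedWindowGapOn (fun μ => MuGM μ ∧ ¬ NearAffine ε₁ ρ μ) r RF (eStar + gF + τF)) (hTF : SiteTailFloor RF τF) :
    Summit.AtomisticToContinuum.Crystallization.Theses.FrustratedLawDichotomy.AperiodicFrustratedLawGap :=
  aperiodicFrustratedLawGap_of_typedLocalGap_nearFar _ ae_muGM_of_minimising hr ε₁ ρ hgN hgF
    (fun μ hμ hN hG hT hNA => texturedLocalGapOn_of_rangeCut hr hWN hTN μ hμ hN hT ⟨hG, hNA⟩)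
    (fun μ hμ hN hG hT hNA => texturedLocalGapOn_of_rangeCut hr hWF hTF μ hμ hN hT ⟨hG, hNA⟩)

/-- ★★★ **THE [FIN] CURRENCY OF RECORD, literal radii** (`R_N = 13`, budget `3/2000`; `R_F = 7`, budget `1/100`; (481) `siteTailFloor_seven_thirteen`):
[FIN](`MuGM ∧ NearAffine ε₁ ρ`, r, 13, e⋆ + gN + 3/2000) ∧ [FIN](`MuGM ∧ ¬NearAffine ε₁ ρ`, r, 7, e⋆ + gF + 1/100), `gN, gF > 0` ⟹ `AperiodicFrustratedLawGap`
BY NAME — the only open hypotheses are two finite-window inequalities over e⋆-μGSC textured windows. [new: junction] -/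
theorem aperiodicFrustratedLawGap_of_gscWindowGap_nearFar_sharp {r : ℝ} (hr : 0 < r) (ε₁ ρ : ℝ) {gN gF : ℝ} (hgN : 0 < gN) (hgF : 0 < gF)
    (hWN : TexturedWindowGapOn (fun μ => MuGM μ ∧ NearAffine ε₁ ρ μ) r 13 (eStar + gN + 3 / 2000))
    (hWF : TexturedWindowGapOn (fun μ => MuGM μ ∧ ¬ NearAffine ε₁ ρ μ) r 7 (eStar + gF + 1 / 100)) :
    Summit.AtomisticToContinuum.Crystallization.Theses.FrustratedLawDichotomy.AperiodicFrustratedLawGap :=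
  aperiodicFrustratedLawGap_of_gscWindowGap_nearFar hr ε₁ ρ hgN hgF hWN siteTailFloor_seven_thirteen.2 hWF siteTailFloor_seven_thirteen.1

/-- (481)'s class-`⊤` and NashM-class windows feed the `MuGM` windows (`TexturedWindowGapOn.of_imp`): the weakening direction, kernel-checked. [new: bookkeeping] -/
example {r R g : ℝ} (hr : 0 < r) (hR : 1 ≤ R) (hg : 0 < g) (hW : TexturedWindowGapOn (fun _ => True) r R (eStar + g + tauSharp R)) :
    Summit.AtomisticToContinuum.Crystallization.Theses.FrustratedLawDichotomy.AperiodicFrustratedLawGap :=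
  aperiodicFrustratedLawGap_of_gscWindowGap hr hR hg (hW.of_imp fun _ _ => trivial)

end Summit.AtomisticToContinuum.Crystallization.Theorems.FrustratedLawDichotomyAtlasReachGSC

end
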